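import Summits.Ventures.HSemireg.CocycleExtension
import Literature.AlgebraicGeometry.Modules.LocalExactness
import Mathlib.Topology.Sheaves.LocallySurjective
import HarnessLib

/-!
# The cocycle extension `0 → B → ext w → A → 0` is short exact and splits over the cover

Sequel to `CocycleExtension.lean` (gluing of the module `ext w` from a `1`-cocycle `w = (w_{xy} : A| → B|)` of local
morphisms on a point-indexed cover).  Here: the maps `ι : B → ext w` (`b ↦ (0, (b|)_x)`) and `π : ext w → A`
(`(a, β) ↦ a`), the LOCAL RETRACTIONS `ret z : ext w|_{U_z} → B|_{U_z}` (`(a, β) ↦ β_z`) with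
`ι ≫ ret z = 𝟙`, and the key identity

  `ret x - ret y = π ≫ w_{xy}`   on `U_x ∩ U_y`   (`restrictHom_ret_sub_ret`),

i.e. the extension splits over every `U_z` and the difference of the splittings is the cocycle `w`; and the short
exactness of `0 → B → ext w → A → 0` (`shortExact`: `π` is locally surjective through the local sections
`a ↦ (a, (w_{xz} a)_x)`).

HONEST FRAMING (cell pub-hsemireg, seat gs-g4; brick C2b of general-structure/COMPLEX-LEIBNIZ-PLAN-gs-g4.md): module-level
sheaf algebra; NOT a door, NOT a named fact; nothing here says HC, HC_CM or HC_AV is proved.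

## References
* R. Hartshorne, *Algebraic Geometry*, GTM 52 (1977), II Ex. 1.22, III.4. [Hartshorne1977]
-/

noncomputable section

set_option backward.isDefEq.respectTransparency false

open CategoryTheory CategoryTheory.Limits AlgebraicGeometry TopologicalSpace Opposite

namespace Summit.Ventures.HSemireg

namespace CocycleExtension

open Literature.AlgebraicGeometry.Modules Literature.AlgebraicGeometry.HodgeTheory CocycleTwist

universe u

variable {X : Scheme.{u}} {c : UnitCocycle X} {A B : X.Modules} (w : LocalOneCocycle c A B)

/-! ### Constructor for morphisms into `ext w` -/

/-- **Constructor for morphisms `M ⟶ ext w`** from additive maps on sections compatible with restriction and the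
action (the `CocycleTwist.homMkTwist` pattern). [folklore] -/
def homMk {M : X.Modules} (Φ : ∀ V : X.Opens, Γ(M, V) →+ Γ(ext w, V))
    (hres₁ : ∀ (V W : X.Opens) (h : W ≤ V) (m : Γ(M, V)),
      fst w (Φ W (M.presheaf.map (homOfLE h).op m)) = A.presheaf.map (homOfLE h).op (fst w (Φ V m)))
    (hres₂ : ∀ (V W : X.Opens) (h : W ≤ V) (m : Γ(M, V)) (x : X),
      comp w (Φ W (M.presheaf.map (homOfLE h).op m)) x =
        B.presheaf.map (homOfLE (inf_le_inf_right (c.U x) h)).op (comp w (Φ V m) x))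
    (hsmul₁ : ∀ (V : X.Opens) (a : Γ(X, V)) (m : Γ(M, V)), fst w (Φ V (a • m)) = a • fst w (Φ V m))
    (hsmul₂ : ∀ (V : X.Opens) (a : Γ(X, V)) (m : Γ(M, V)) (x : X),
      comp w (Φ V (a • m)) x = X.presheaf.map (homOfLE (inf_le_left : V ⊓ c.U x ≤ V)).op a • comp w (Φ V m) x) :
    M ⟶ ext w where
  val := PresheafOfModules.homMk
    { app := fun V => AddCommGrpCat.ofHom (Φ V.unop)
      naturality := fun V W i => by
        ext m
        apply ext_ext
        · change fst w (Φ W.unop (M.presheaf.map i m)) = A.presheaf.map _ (fst w (Φ V.unop m))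
          have ei : i = (homOfLE i.unop.le).op := Subsingleton.elim _ _
          rw [ei]
          exact hres₁ V.unop W.unop i.unop.le m
        · intro x
          change comp w (Φ W.unop (M.presheaf.map i m)) x = B.presheaf.map _ (comp w (Φ V.unop m) x)
          have ei : i = (homOfLE i.unop.le).op := Subsingleton.elim _ _
          rw [ei]
          exact hres₂ V.unop W.unop i.unop.le m x }
    (fun V a m => ext_ext w ((hsmul₁ V.unop a m).trans (fst_smul w a (Φ V.unop m)).symm)
      fun x => (hsmul₂ V.unop a m x).trans (comp_smul w a (Φ V.unop m) x).symm)

/-- Sections of `homMk`: the given maps. [folklore] -/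
@[simp]
theorem homMk_app {M : X.Modules} (Φ : ∀ V : X.Opens, Γ(M, V) →+ Γ(ext w, V)) (h₁ h₂ h₃ h₄) (V : X.Opens)
    (m : Γ(M, V)) : (homMk w Φ h₁ h₂ h₃ h₄).app V m = Φ V m := rfl

/-! ### `ι : B → ext w` and `π : ext w → A` -/

/-- The family `(0, (b|_{V ∩ U_x})_x)` of a section `b ∈ Γ(B, V)` satisfies the relation. [folklore] -/
theorem inFamily_mem {V : X.Opens} (b : Γ(B, V)) :
    ((0, fun x => B.presheaf.map (homOfLE (inf_le_left : V ⊓ c.U x ≤ V)).op b) : PairFamily V) ∈ extFamilies w V := by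
  intro x y W hW hx hy
  simp only [map_zero, appLE_zero_right]
  rw [← CategoryTheory.comp_apply, ← Functor.map_comp, ← CategoryTheory.comp_apply, ← Functor.map_comp, sub_eq_zero]
  rfl

/-- **`ι : B ⟶ ext w`**, `b ↦ (0, (b|_{V ∩ U_x})_x)`. [folklore] -/
def ι : B ⟶ ext w :=
  homMk w (fun V =>
    { toFun := fun b => mk w _ (inFamily_mem w b)
      map_zero' := ext_ext w (by simp) fun x => by simp
      map_add' := fun b b' => ext_ext w (by simp) fun x => by simp })
    (fun V W h b => by simp)
    (fun V W h b x => by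
      change B.presheaf.map _ (B.presheaf.map _ b) = B.presheaf.map _ (B.presheaf.map _ b)
      rw [presheaf_map_map, presheaf_map_map]
      exact presheaf_map_congr B _ _ b)
    (fun V a b => by simp)
    (fun V a b x => by
      change B.presheaf.map _ (a • b) = _ • B.presheaf.map _ b
      rw [Scheme.Modules.map_smul])

/-- Components of `ι b`: zero `A`-part. [folklore] -/
@[simp] theorem fst_ι_app {V : X.Opens} (b : Γ(B, V)) : fst w ((ι w).app V b) = 0 := rfl

/-- Components of `ι b`: `β_x = b|_{V ∩ U_x}`. [folklore] -/
@[simp] theorem comp_ι_app {V : X.Opens} (b : Γ(B, V)) (x : X) :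
    comp w ((ι w).app V b) x = B.presheaf.map (homOfLE (inf_le_left : V ⊓ c.U x ≤ V)).op b := rfl

/-- **`π : ext w ⟶ A`**, `(a, β) ↦ a`. [folklore] -/
def π : ext w ⟶ A where
  val := PresheafOfModules.homMk
    { app := fun V => AddCommGrpCat.ofHom
        { toFun := fun s => fst w s
          map_zero' := rfl
          map_add' := fun _ _ => rfl }
      naturality := fun {V W} i => by
        ext s
        have ei : i = (homOfLE i.unop.le).op := Subsingleton.elim _ _
        rw [ei]
        rfl }
    (fun V a s => rfl)

/-- Sections of `π`. [folklore] -/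
@[simp] theorem π_app_apply {V : X.Opens} (s : Γ(ext w, V)) : (π w).app V s = fst w s := rfl

/-- `ι ≫ π = 0`. [folklore] -/
theorem ι_comp_π : ι w ≫ π w = 0 :=
  Scheme.Modules.hom_ext _ _ fun _ => AddCommGrpCat.ext fun _ => rfl

/-! ### The local retractions `ret z : ext w|_{U_z} → B|_{U_z}` -/

/-- The value of the local retraction on `V ⊆ U_z`: `(a, β) ↦ β_z` (transported from `V ∩ U_z` to `V`). [folklore] -/
def retFun (z : X) {V : X.Opens} (hV : V ≤ c.U z) (s : Γ(ext w, V)) : Γ(B, V) :=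
  B.presheaf.map (homOfLE (le_inf le_rfl hV : V ≤ V ⊓ c.U z)).op (comp w s z)

/-- `retFun` is additive. [folklore] -/
theorem retFun_add (z : X) {V : X.Opens} (hV : V ≤ c.U z) (s t : Γ(ext w, V)) :
    retFun w z hV (s + t) = retFun w z hV s + retFun w z hV t := by
  rw [retFun, comp_add, map_add]; rfl

/-- `retFun` commutes with restriction. [folklore] -/
theorem map_retFun (z : X) {V W : X.Opens} (hV : V ≤ c.U z) (h : W ≤ V) (s : Γ(ext w, V)) :
    B.presheaf.map (homOfLE h).op (retFun w z hV s) = retFun w z (h.trans hV) ((ext w).presheaf.map (homOfLE h).op s) := by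
  rw [retFun, retFun, comp_map, presheaf_map_map, presheaf_map_map]
  exact presheaf_map_congr B _ _ _

/-- `retFun` is `𝒪`-linear. [folklore] -/
theorem retFun_smul (z : X) {V : X.Opens} (hV : V ≤ c.U z) (a : Γ(X, V)) (s : Γ(ext w, V)) :
    retFun w z hV (a • s) = a • retFun w z hV s := by
  rw [retFun, retFun, comp_smul, Scheme.Modules.map_smul, ← CategoryTheory.comp_apply, ← Functor.map_comp]
  congr 1
  have : (homOfLE (inf_le_left : V ⊓ c.U z ≤ V)).op ≫ (homOfLE (le_inf le_rfl hV : V ≤ V ⊓ c.U z)).op = 𝟙 _ :=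
    Subsingleton.elim _ _
  rw [this, CategoryTheory.Functor.map_id]
  rfl

/-- **The local retraction `ret z : ext w|_{U_z} ⟶ B|_{U_z}`**, `(a, β) ↦ β_z`. [folklore] -/
def ret (z : X) : (ext w).over (c.U z) ⟶ B.over (c.U z) where
  val := PresheafOfModules.homMk
    { app := fun V => AddCommGrpCat.ofHom
        { toFun := fun s => retFun w z V.unop.hom.le s
          map_zero' := by
            change retFun w z _ 0 = 0
            rw [retFun, comp_zero, map_zero]
          map_add' := fun s t => retFun_add w z _ s t }
      naturality := fun {V W} i => by
        ext s
        change retFun w z W.unop.hom.le ((ext w).presheaf.map i.unop.left.op s) =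
          B.presheaf.map i.unop.left.op (retFun w z V.unop.hom.le s)
        have ei : i.unop.left = homOfLE i.unop.left.le := Subsingleton.elim _ _
        rw [ei, map_retFun] }
    (fun V a s => retFun_smul w z V.unop.hom.le a s)

/-- Values of `ret z`: `(a, β) ↦ β_z|`. [folklore] -/
theorem appLE_ret (z : X) {V : X.Opens} (k : V ⟶ c.U z) (s : Γ(ext w, V)) :
    appLE (ret w z) k s = B.presheaf.map (homOfLE (le_inf le_rfl k.le : V ≤ V ⊓ c.U z)).op (comp w s z) := rfl

/-- **`ι| ≫ ret z = 𝟙`**: `ret z` retracts `ι` over `U_z`. [folklore] -/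
theorem ι_comp_ret (z : X) : (SheafOfModules.overFunctor _ (c.U z)).map (ι w) ≫ ret w z = 𝟙 _ := by
  refine hom_ext_of_appLE fun V k (b : Γ(B, V)) => ?_
  rw [appLE_comp, appLE_over_map, appLE_ret, appLE_id, comp_ι_app, ← CategoryTheory.comp_apply, ← Functor.map_comp]
  have : (homOfLE (inf_le_left : V ⊓ c.U z ≤ V)).op ≫ (homOfLE (le_inf le_rfl k.le : V ≤ V ⊓ c.U z)).op = 𝟙 _ :=
    Subsingleton.elim _ _
  rw [this, B.presheaf.map_id]
  rfl

/-- **`ret x - ret y = π ≫ w_{xy}` on `U_x ∩ U_y`**: the difference of the local splittings of `ext w` is the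
cocycle (the gluing relation `β_x - β_y = w_{xy}(a)`, as an identity of local morphisms on any `V ⊆ U_x ∩ U_y`).
[cite: Hartshorne1977, III.4] -/
theorem ret_sub_ret (x y : X) {V : X.Opens} (hx : V ≤ c.U x) (hy : V ≤ c.U y) :
    restrictHom (homOfLE hx) (ret w x) - restrictHom (homOfLE hy) (ret w y) =
      restrictHom (homOfLE hx) ((SheafOfModules.overFunctor _ (c.U x)).map (π w)) ≫ w.w x y V hx hy := by
  refine hom_ext_of_appLE fun W k (s : Γ(ext w, W)) => ?_
  change appLE (restrictHom (homOfLE hx) (ret w x)) k s - appLE (restrictHom (homOfLE hy) (ret w y)) k s = _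
  rw [appLE_restrictHom, appLE_restrictHom, appLE_ret, appLE_ret, appLE_comp, appLE_restrictHom, appLE_over_map,
    π_app_apply]
  have h := comp_rel w s x y (W := W) le_rfl (k.le.trans hx) (k.le.trans hy)
  have e1 : (homOfLE (le_inf le_rfl ((k ≫ homOfLE hx).le) : W ≤ W ⊓ c.U x)).op =
      (homOfLE (le_inf (le_refl W) (k.le.trans hx))).op := Subsingleton.elim _ _
  have e2 : (homOfLE (le_inf le_rfl ((k ≫ homOfLE hy).le) : W ≤ W ⊓ c.U y)).op =
      (homOfLE (le_inf (le_refl W) (k.le.trans hy))).op := Subsingleton.elim _ _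
  rw [e1, e2, h, ← w.restrictHom_w x y hx hy k, appLE_restrictHom]
  have e3 : (homOfLE (le_refl W)).op = 𝟙 (op W) := Subsingleton.elim _ _
  rw [e3, A.presheaf.map_id]
  exact appLE_congr_hom _ _ _ _

/-! ### Short exactness -/

/-- The local section `a ↦ (a, (w_{xz}(a|))_x)` over `V ⊆ U_z` satisfies the relation (cocycle condition
`w_{xz} - w_{yz} = w_{xy}`). [folklore] -/
theorem secFamily_mem (z : X) {V : X.Opens} (hV : V ≤ c.U z) (a : Γ(A, V)) :
    ((a, fun x => appLE (w.w x z (V ⊓ c.U x) inf_le_right (inf_le_left.trans hV)) (𝟙 _)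
      (A.presheaf.map (homOfLE (inf_le_left : V ⊓ c.U x ≤ V)).op a)) : PairFamily V) ∈ extFamilies w V := by
  intro x y W hW hx hy
  have hz : W ≤ c.U z := hW.trans hV
  change B.presheaf.map _ (appLE _ _ _) - B.presheaf.map _ (appLE _ _ _) = _
  rw [← appLE_map, ← appLE_map, presheaf_map_map, presheaf_map_map,
    appLE_congr_hom (w.w x z _ _ _) _ (𝟙 W ≫ homOfLE (le_inf hW hx)),
    appLE_congr_hom (w.w y z _ _ _) _ (𝟙 W ≫ homOfLE (le_inf hW hy)),
    ← appLE_restrictHom (homOfLE (le_inf hW hx)), ← appLE_restrictHom (homOfLE (le_inf hW hy)), w.restrictHom_w,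
    w.restrictHom_w]
  change appLE _ _ (A.presheaf.map _ a) - appLE _ _ (A.presheaf.map _ a) = appLE _ _ (A.presheaf.map _ a)
  have ea : ∀ f : W ⟶ V, A.presheaf.map f.op a = A.presheaf.map (homOfLE hW).op a := fun f =>
    presheaf_map_congr A f (homOfLE hW) a
  simp only [ea]
  rw [w.w_cocycle x y z W hx hy hz, appLE_add, add_sub_cancel_right]

/-- **`0 → B → ext w → A → 0` is short exact.** [cite: Hartshorne1977, II Ex. 1.22] -/
theorem shortExact : (ShortComplex.mk (ι w) (π w) (ι_comp_π w)).ShortExact where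
  exact := by
    refine exact_of_locally_exact _ fun V s (hs : fst w s = 0) v hv => ?_
    -- `β` glues to a section of `B` over `V`: the relation reads `β_x| = β_y|`
    let G : TopCat.Sheaf Ab X := ⟨B.presheaf, Scheme.Modules.isSheaf B⟩
    have hcov : V ≤ ⨆ x : X, V ⊓ c.U x := fun v hv => Opens.mem_iSup.mpr ⟨v, ⟨hv, c.mem v⟩⟩
    have hcompat : TopCat.Presheaf.IsCompatible G.1 (fun x : X => V ⊓ c.U x) fun x => comp w s x := by
      intro x y
      have h := comp_rel w s x y (W := (V ⊓ c.U x) ⊓ (V ⊓ c.U y)) (inf_le_left.trans inf_le_left)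
        (inf_le_left.trans inf_le_right) (inf_le_right.trans inf_le_right)
      rw [hs, map_zero, appLE_zero_right, sub_eq_zero] at h
      exact h
    obtain ⟨b, hb, -⟩ := G.existsUnique_gluing' (fun x : X => V ⊓ c.U x) V (fun x => homOfLE inf_le_left) hcov
      (fun x => comp w s x) hcompat
    have hid : (ext w).presheaf.map (𝟙 V).op s = s := presheaf_map_id_apply (ext w) V s
    refine ⟨V, 𝟙 V, hv, b, ?_⟩
    change (ι w).app V b = (ext w).presheaf.map (𝟙 V).op s
    rw [hid]
    exact ext_ext w (by rw [fst_ι_app, hs]) fun x => by rw [comp_ι_app]; exact hb x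
  mono_f := by
    change Mono (ι w)
    have hinj : ∀ V : X.Opens, Function.Injective ((ι w).app V) := fun V b b' h => by
      have hcov : V ≤ ⨆ x : X, V ⊓ c.U x := fun v hv => Opens.mem_iSup.mpr ⟨v, ⟨hv, c.mem v⟩⟩
      refine TopCat.Sheaf.eq_of_locally_eq' (⟨B.presheaf, Scheme.Modules.isSheaf B⟩ : TopCat.Sheaf Ab X)
        (fun x : X => V ⊓ c.U x) V (fun x => homOfLE inf_le_left) hcov b b' fun x => ?_
      have hx := congrArg (fun s => comp w s x) h
      simpa only [comp_ι_app] using hx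
    haveI : ∀ U, Mono ((ι w).mapPresheaf.app U) := fun U => ConcreteCategory.mono_of_injective _ (hinj U.unop)
    haveI : Mono (ι w).mapPresheaf := NatTrans.mono_of_mono_app _
    exact (Scheme.Modules.toPresheaf X).mono_of_mono_map this
  epi_g := by
    have hls : TopCat.Presheaf.IsLocallySurjective (π w).mapPresheaf := by
      rw [TopCat.Presheaf.isLocallySurjective_iff]
      intro V a v hv
      refine ⟨V ⊓ c.U v, inf_le_left, ⟨mk w _ (secFamily_mem w v (V := V ⊓ c.U v) inf_le_right
        (A.presheaf.map (homOfLE inf_le_left).op a)), rfl⟩, ⟨hv, c.mem v⟩⟩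
    have h1 : Epi ((SheafOfModules.toSheaf X.ringCatSheaf).map (π w)) :=
      (TopCat.Sheaf.isLocallySurjective_iff_epi _).mp hls
    have h2 := (SheafOfModules.toSheaf X.ringCatSheaf).epi_of_epi_map h1
    exact ⟨fun _ _ hh => (@cancel_epi _ _ _ _ _ _ h2 _ _).mp hh⟩

end CocycleExtension

end Summit.Ventures.HSemireg

end
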